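import Summits.ResolutionOfSingularities.ResolutionOfSingularities.Theorems.FrobeniusLadderFInjectiveMacaulayficationComapFinsetProd
import Summits.ResolutionOfSingularities.ResolutionOfSingularities.Theorems.FrobeniusLadderFInjectiveMacaulayficationSupportFinsetProd
import Summits.ResolutionOfSingularities.ResolutionOfSingularities.Theorems.FrobeniusLadderFInjectiveMacaulayficationIsBlowupStalkTransfer
import Summits.ResolutionOfSingularities.ResolutionOfSingularities.Theorems.FrobeniusLadderFInjectiveMacaulayficationIsBlowupStalkOffSupport
import Summits.ResolutionOfSingularities.ResolutionOfSingularities.Theorems.FrobeniusLadderFInjectiveMacaulayficationRestrictStalkIso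
import Summits.ResolutionOfSingularities.ResolutionOfSingularities.Theorems.FrobeniusLadderFInjectiveMacaulayficationReductions
import Literature.AlgebraicGeometry.Resolution.BlowupsExistence
import Literature.AlgebraicGeometry.Resolution.BlowupsIntegral
import Literature.AlgebraicGeometry.Resolution.BlowupsProperProofs
import Mathlib.AlgebraicGeometry.IdealSheaf.Functorial
import Mathlib.AlgebraicGeometry.Morphisms.FiniteType
import Mathlib.AlgebraicGeometry.FunctionField
import Mathlib.AlgebraicGeometry.Noetherian
import HarnessLib

/-!
# Crux `FInjectiveMacaulayfication`: THE SURGERY GLUE — finitely many point-supported centres good over their points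
give an F-injective Macaulayfication (line `isolation`, stub `stub_surgeryGlue`; proved by the lead of line `Sketch`, cycle 7)

Support file for crux `stmt-ResolutionOfSingularities-15315` (`FrobeniusLadder.FInjectiveMacaulayfication`, route
`ResolutionOfSingularities/FrobeniusLadder`, rung 2). The strategist's ISOLATION SPLIT (`Cruxes/…/STRATEGY-CENSUS.md`,
`Lines/isolation.lean`) cuts the crux into ISO ("F-injective off finitely many closed points") and PT ("finitely many bad
points can be repaired"); PT = `stub_badPointsClosed` + `stub_pointCentreExists` (the open local core) + THIS glue.

Statement (registered `stub_surgeryGlue`, verbatim): `X₁` integral, separated, of finite type over a field `k` of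
characteristic `p`, all stalks Cohen–Macaulay; `T` a finite set of closed points containing every point at which some
parameter ideal is not Frobenius closed; for each `b ∈ T` an ideal sheaf `J b ≠ ⊥` with `supp (J b) = {b}` such that EVERY
blow-up of `X₁` along `J b` satisfies the full stalk clause (domain; systems of parameters weakly regular; parameter ideals
Frobenius closed) at its points over `b`. Then `X₁` has a proper birational model with the full clause at every stalk.

Proof: blow up the PRODUCT `∏_{b ∈ T} J b` (`exists_isBlowup`): its support is `T` (`SupportFinsetProd`), it is non-zero
(otherwise `T = X₁`, the generic point would be closed, `X₁` a point, and `supp (J b) = X₁` would force `J b = ⊥`), so the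
blow-up `π` is proper (`IsBlowup.isProper`), birational and integral (`IsBlowup.isBirational'`, `IsBlowup.isIntegral`).
At a point `x` NOT over `T` the blow-up is a local isomorphism (`IsBlowupStalkOffSupport`) and the stalk of `X₁` below is a
good Cohen–Macaulay domain. At a point `x` over `b ∈ T`, restrict to the open `U = X₁ ∖ (T ∖ {b}) ∋ b`: there the product
restricts to `J b` (`ComapFinsetProd`: `comap` along an open immersion is multiplicative, and the other factors have empty
support on `U`, hence are `⊤`), so `π ∣_ U` and the restriction of any global blow-up `π_b` of `J b` are two blow-ups of `U`
along the same ideal sheaf (`IsBlowup.restrict`), hence isomorphic over `U` (`IsBlowupStalkTransfer`, from `IsBlowup.unique`):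
the stalk of `X'` at `x` is the stalk of `X_b` at a point over `b` (`RestrictStalkIso`), good by hypothesis.

References: U. Görtz, T. Wedhorn, *Algebraic Geometry I*, Def. 13.90, Prop. 13.91, (13.19); The Stacks Project, Tags 01OF,
02OS, 02ND, 080A. [folklore]
-/

-- single-problem summit: the doubled namespace component is forced
set_option linter.dupNamespace false

noncomputable section

namespace Summit.ResolutionOfSingularities.ResolutionOfSingularities.Theorems.FInjectiveMacaulayfication.SurgeryGlue

open AlgebraicGeometry CategoryTheory Literature.AlgebraicGeometry.Resolution TopologicalSpace

/-- A finite set of closed points is closed. [folklore] -/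
theorem isClosed_of_finite_of_forall_isClosed_singleton {X : Type} [TopologicalSpace X] {T : Set X}
    (hT : T.Finite) (hcl : ∀ b ∈ T, IsClosed ({b} : Set X)) : IsClosed T := by
  rw [← Set.biUnion_of_singleton T]
  exact hT.isClosed_biUnion fun b hb => hcl b hb

/-- **THE SURGERY GLUE** (registered stub `stub_surgeryGlue` of crux stmt-ResolutionOfSingularities-15315, line `isolation`):
see the module docstring. [folklore] -/
theorem stub_surgeryGlue : ∀ (p : ℕ), p.Prime → ∀ (k : Type) [Field k] [CharP k p] (X₁ : Scheme.{0}) (f₁ : X₁ ⟶ Spec (.of k)),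
    IsSeparated f₁ → LocallyOfFiniteType f₁ → QuasiCompact f₁ → IsIntegral X₁ →
    (∀ x : X₁, ∀ d : ℕ, ringKrullDim (X₁.presheaf.stalk x) = d → ∀ s : Fin d → X₁.presheaf.stalk x, (Ideal.span (Set.range s)).radical.IsMaximal → RingTheory.Sequence.IsWeaklyRegular (X₁.presheaf.stalk x) (List.ofFn s)) →
    ∀ (T : Set X₁), T.Finite → (∀ b ∈ T, IsClosed ({b} : Set X₁)) →
    (∀ x : X₁, (¬ ∀ d : ℕ, ringKrullDim (X₁.presheaf.stalk x) = d → ∀ s : Fin d → X₁.presheaf.stalk x, (Ideal.span (Set.range s)).radical.IsMaximal → ∀ y : X₁.presheaf.stalk x, (∃ e : ℕ, y ^ p ^ e ∈ Ideal.span ((fun z : X₁.presheaf.stalk x => z ^ p ^ e) '' (Ideal.span (Set.range s) : Set (X₁.presheaf.stalk x)))) → y ∈ Ideal.span (Set.range s)) → x ∈ T) →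
    ∀ (J : X₁ → X₁.IdealSheafData),
    (∀ b ∈ T, J b ≠ ⊥ ∧ ((J b).support : Set X₁) = {b} ∧
      ∀ (X' : Scheme.{0}) (π : X' ⟶ X₁), Literature.AlgebraicGeometry.Resolution.IsBlowup π (J b) →
        ∀ x' : X', π.base x' = b → IsDomain (X'.presheaf.stalk x') ∧ ∀ d : ℕ, ringKrullDim (X'.presheaf.stalk x') = d → ∀ s : Fin d → X'.presheaf.stalk x', (Ideal.span (Set.range s)).radical.IsMaximal → RingTheory.Sequence.IsWeaklyRegular (X'.presheaf.stalk x') (List.ofFn s) ∧ ∀ y : X'.presheaf.stalk x', (∃ e : ℕ, y ^ p ^ e ∈ Ideal.span ((fun z : X'.presheaf.stalk x' => z ^ p ^ e) '' (Ideal.span (Set.range s) : Set (X'.presheaf.stalk x')))) → y ∈ Ideal.span (Set.range s)) →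
    ∃ (X' : Scheme.{0}) (π : X' ⟶ X₁), IsProper π ∧ Literature.AlgebraicGeometry.Resolution.IsBirational π ∧
      ∀ x : X', IsDomain (X'.presheaf.stalk x) ∧ ∀ d : ℕ, ringKrullDim (X'.presheaf.stalk x) = d → ∀ s : Fin d → X'.presheaf.stalk x, (Ideal.span (Set.range s)).radical.IsMaximal → RingTheory.Sequence.IsWeaklyRegular (X'.presheaf.stalk x) (List.ofFn s) ∧ ∀ y : X'.presheaf.stalk x, (∃ e : ℕ, y ^ p ^ e ∈ Ideal.span ((fun z : X'.presheaf.stalk x => z ^ p ^ e) '' (Ideal.span (Set.range s) : Set (X'.presheaf.stalk x)))) → y ∈ Ideal.span (Set.range s) := by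
  intro p hp k _ _ X₁ f₁ _ hlft _ hint hCM T hT hTcl hbad J hJ
  classical
  haveI : Fact p.Prime := ⟨hp⟩
  haveI : IsLocallyNoetherian X₁ := LocallyOfFiniteType.isLocallyNoetherian f₁
  -- the total centre and its blow-up
  obtain ⟨X', π, hπ⟩ := exists_isBlowup X₁ (∏ b ∈ hT.toFinset, J b)
  -- its support is `T`
  have hsupp : ((∏ b ∈ hT.toFinset, J b).support : Set X₁) = T := by
    rw [SupportFinsetProd.stub_supportFinsetProd]
    ext x
    simp only [Set.mem_iUnion, Set.Finite.mem_toFinset, exists_prop]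
    constructor
    · rintro ⟨b, hb, hx⟩
      rw [(hJ b hb).2.1, Set.mem_singleton_iff] at hx
      rwa [hx]
    · intro hx
      refine ⟨x, hx, ?_⟩
      rw [(hJ x hx).2.1]
      exact Set.mem_singleton x
  -- it is non-zero
  have hJ0 : (∏ b ∈ hT.toFinset, J b) ≠ ⊥ := by
    intro hbot
    have huniv : T = Set.univ := by
      rw [← hsupp, hbot, Scheme.IdealSheafData.support_bot]
      rfl
    have hξT : genericPoint X₁ ∈ T := huniv ▸ Set.mem_univ _
    have hall : ∀ x : X₁, x = genericPoint X₁ := fun x => by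
      have hx : x ∈ closure ({genericPoint X₁} : Set X₁) := (genericPoint_specializes x).mem_closure
      rwa [(hTcl _ hξT).closure_eq, Set.mem_singleton_iff] at hx
    have hsuppξ : (J (genericPoint X₁)).support = ⊤ := by
      apply SetLike.coe_injective
      rw [(hJ _ hξT).2.1]
      ext x
      simp only [Set.mem_singleton_iff, Closeds.coe_top, Set.mem_univ, iff_true]
      exact hall x
    exact (hJ _ hξT).1 (Scheme.IdealSheafData.support_eq_top_iff.mp hsuppξ)
  refine ⟨X', π, hπ.isProper, hπ.isBirational' hJ0, fun x => ?_⟩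
  haveI : IsIntegral X' := hπ.isIntegral hJ0
  by_cases hxT : π.base x ∈ T
  · -- over the bad point `b = π x`: restrict to `U = X₁ ∖ (T ∖ {b})`
    have hUopen : IsOpen ((T \ {π.base x})ᶜ : Set X₁) :=
      (isClosed_of_finite_of_forall_isClosed_singleton (hT.subset fun _ h => h.1)
        fun b hb => hTcl b hb.1).isOpen_compl
    have hbU : π.base x ∈ (⟨(T \ {π.base x})ᶜ, hUopen⟩ : X₁.Opens) := fun h => h.2 rfl
    -- the product restricts to `J b` on `U`
    have hres := hπ.restrict ⟨(T \ {π.base x})ᶜ, hUopen⟩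
    rw [ComapFinsetProd.stub_comapFinsetProdOfIsOpenImmersion] at hres
    have hfac : ∀ b' ∈ hT.toFinset, b' ≠ π.base x →
        (J b').comap (Scheme.Opens.ι ⟨(T \ {π.base x})ᶜ, hUopen⟩) = ⊤ := by
      intro b' hb' hne
      rw [← Scheme.IdealSheafData.support_eq_bot_iff]
      apply SetLike.coe_injective
      rw [Scheme.IdealSheafData.support_comap, Closeds.coe_preimage, (hJ b' (hT.mem_toFinset.mp hb')).2.1, Closeds.coe_bot,
        Set.eq_empty_iff_forall_notMem]
      intro u hu
      rw [Set.mem_preimage, Set.mem_singleton_iff] at hu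
      have hu1 : u.1 = b' := by simpa using hu
      have hu' : u.1 ∈ ((T \ {π.base x})ᶜ : Set X₁) := u.2
      rw [hu1] at hu'
      exact hu' ⟨hT.mem_toFinset.mp hb', fun h => hne h⟩
    have hprod : ∏ b' ∈ hT.toFinset, (J b').comap (Scheme.Opens.ι ⟨(T \ {π.base x})ᶜ, hUopen⟩) =
        (J (π.base x)).comap (Scheme.Opens.ι ⟨(T \ {π.base x})ᶜ, hUopen⟩) := by
      rw [← Finset.mul_prod_erase _ _ (hT.mem_toFinset.mpr hxT), Finset.prod_eq_one, mul_one]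
      intro b' hb'
      obtain ⟨hne, hb'T⟩ := Finset.mem_erase.mp hb'
      rw [hfac b' hb'T hne]
      rfl
    rw [hprod] at hres
    -- a global blow-up of `J b`, restricted to `U`
    obtain ⟨Xb, πb, hπb⟩ := exists_isBlowup X₁ (J (π.base x))
    have hresb := hπb.restrict ⟨(T \ {π.base x})ᶜ, hUopen⟩
    -- two blow-ups of `U` along the same ideal sheaf: the stalk of `X'` at `x` is a stalk of `Xb` over `b`
    have hxU : x ∈ π ⁻¹ᵁ ⟨(T \ {π.base x})ᶜ, hUopen⟩ := hbU
    obtain ⟨x'', hx''eq, ⟨e1⟩⟩ := IsBlowupStalkTransfer.stub_isBlowupStalkTransfer _ _ _ _ _ _ hres hresb ⟨x, hxU⟩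
    obtain ⟨hpt, ⟨e0⟩⟩ := RestrictStalkIso.stub_restrictStalkIso X' X₁ π ⟨(T \ {π.base x})ᶜ, hUopen⟩ ⟨x, hxU⟩
    obtain ⟨hptb, ⟨e2⟩⟩ := RestrictStalkIso.stub_restrictStalkIso Xb X₁ πb ⟨(T \ {π.base x})ᶜ, hUopen⟩ x''
    have hover : πb.base x''.1 = π.base x := by
      rw [← hptb, hx''eq, hpt]
    have hcl := (hJ (π.base x) hxT).2.2 Xb πb hπb x''.1 hover
    exact fiClause_of_ringEquiv p (e2.symm.trans (e1.symm.trans e0)) hcl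
  · -- off `T`: the blow-up is a local isomorphism and the stalk below is a good Cohen–Macaulay domain
    have hxs : π.base x ∉ ((∏ b ∈ hT.toFinset, J b).support : Set X₁) := by rwa [hsupp]
    obtain ⟨e⟩ := IsBlowupStalkOffSupport.stub_isBlowupStalkOffSupport X₁ X' _ π hπ x hxs
    have hF : ∀ d : ℕ, ringKrullDim (X₁.presheaf.stalk (π.base x)) = d →
        ∀ s : Fin d → X₁.presheaf.stalk (π.base x), (Ideal.span (Set.range s)).radical.IsMaximal →
          ∀ y : X₁.presheaf.stalk (π.base x), (∃ e : ℕ, y ^ p ^ e ∈ Ideal.span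
            ((fun z : X₁.presheaf.stalk (π.base x) => z ^ p ^ e) ''
              (Ideal.span (Set.range s) : Set (X₁.presheaf.stalk (π.base x))))) → y ∈ Ideal.span (Set.range s) := by
      by_contra hcon
      exact hxT (hbad _ hcon)
    exact fiClause_of_ringEquiv p e.symm
      ⟨inferInstance, fun d hd s hs => ⟨hCM _ d hd s hs, hF d hd s hs⟩⟩

end Summit.ResolutionOfSingularities.ResolutionOfSingularities.Theorems.FInjectiveMacaulayfication.SurgeryGlue

end
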